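import Summits.BirchSwinnertonDyer.BirchSwinnertonDyer.Theorems.ByReductionTypeAtTwoGoodOrdTowerCoinvDevissage
import Summits.BirchSwinnertonDyer.BirchSwinnertonDyer.Theorems.ByReductionTypeAtTwoGoodOrdTowerCoinvKummer
import Summits.BirchSwinnertonDyer.BirchSwinnertonDyer.Theorems.ByReductionTypeAtTwoGoodOrdTowerLayerLutz
import Summits.BirchSwinnertonDyer.BirchSwinnertonDyer.Theorems.ByReductionTypeAtTwoGoodOrdTowerEPTower
import Summits.BirchSwinnertonDyer.BirchSwinnertonDyer.Theorems.ByReductionTypeAtTwoGoodOrdTowerHensel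
import Summits.BirchSwinnertonDyer.BirchSwinnertonDyer.Theorems.ByReductionTypeAtTwoMultTowerNS2TorsionEmbedding
import Summits.BirchSwinnertonDyer.BirchSwinnertonDyer.Theorems.ByReductionTypeAtTwoTowerLayerNumeric
import Literature.NumberTheory.EllipticCurves.SerreOpenImageOrdinaryInertiaProofs
import HarnessLib

/-!
# Route `ByReductionTypeAtTwo`, item `OrdKatoHalfAtTwo` (stmt-BirchSwinnertonDyer-19271), TOWER road: the GOOD-ORDINARY
# local constant at `v ∣ 2` WITHOUT the print binder — `#𝒦_{v,n}[2^∞][2] ≤ 4` is a KERNEL THEOREM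

HONEST FRAMING (cell `bsd-2adic`, run/shared/lean/pub/bsd-2adic/, seat `bsd-2adic-tower-1` GEN 11, HUMAN RULINGS
D-0036 / D-0054 / D-0074): TOOL theorem only (no definition, no named fact, no `sorry`); it closes no item by itself;
nothing is booked; BSD is not proved by any of this. WHAT IT DOES: it removes the PRINT binder
`hS34 : Greenberg1999.lemma34_localTowerKerPrimary_cyclicExtension_rat` (Greenberg, LNM 1716, §3 Lemma 3.4 / Prop. 2.5,
unproved in the tree) from its one consumed projection on the good-ordinary side of the K4 tower road,
`pTorsion_localTowerKer_at_two_le_four` (Theorems/ByReductionTypeAtTwoTowerLayerNumeric): the statement below has the SAME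
conclusion with `hS34` DROPPED. The planner sized this «XL, unstaffed» (HOME/tower/SCOPE-hS34-layer-kernel-at-2-GEN7.md);
it is assembled here from the GEN 11 kernel bricks G1 (`…CoinvDevissage`), G2/G3 (`…CoinvCocycle`, `…CoinvKummer`), G4
(`…Hensel`), G5 (`…EPTower`), G6a–c (`…LayerField`, `…Lattice`, `…LayerLutz`) and GEN 8's BRICK 11
(`MultTowerNS2.finite_torsionBy_localTowerKerPrimary_and_card_le`).

THE PROOF (Greenberg §2 Prop. 2.5 + §3 Lemma 3.4 at `p = 2`, `K = ℚ`, `v ∣ 2` good ordinary, `κ` cyclotomic, layer `n`):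
with `Γ = Γ_{ℚ_v}`, `H_∞ ⊴ H_n ≤ Γ` the local tower subgroups, `g ∈ I_{ℚ_v} ∩ H_n` a topological generator over `H_∞`
(G4), `A = E(K̄_v)`, `A₁ = ker red₀ = Ê(𝔪̄)`, `M = A^{H_∞}`, `M₁ = A₁^{H_∞}`, `T = Ẽ(k̄)`:
`#𝒦_{v,n}[2^∞][2] ≤ #(M/(g−1)M)[2]` (BRICK 11) `≤ #(M₁/(g−1)M₁)[2] · #T[2]` (G1; `red₀ ∘ (g − 1) = 0` as `g` is inertial,
Hensel lifts of the `H_∞`-fixed — hence Frobenius-fixed — reductions, G4) with `#T[2] ≤ 2` (ordinary, G4), and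
`#(M₁/(g−1)M₁)[2] · #(A₁^{H_n}/2) ≤ #Hom_cont(H_n, ℤ/2) ≤ 2^{2^n+2}` (G3 + G5: local EP characteristic up the tower) while
`#(A₁^{H_n}/2) = #(ℤ₂/2)^{[L_n:ℚ₂]} · #A₁^{H_n}[2] = 2^{2^n} · 2` (G6c: Lutz at the layer; `Ê[2] = {0, P₁}` is rational),
so `#(M₁/(g−1)M₁)[2] ≤ 2` and the total is `≤ 4`.

* **`pTorsion_localTowerKer_at_two_le_four_kernel`** — for `W/ℚ` globally minimal, good ordinary at `2`, `κ` the
  cyclotomic `ℤ₂`-extension, `v ∣ 2` and every `n`: `𝒦_{v,n}[2^∞][2]` is finite with at most `4` elements — the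
  conclusion of `pTorsion_localTowerKer_at_two_le_four W hS34 …` with NO `hS34`.

References: R. Greenberg, LNM 1716 (1999), §2 Prop. 2.5, §3 Lemmas 3.3–3.4; J. Silverman, *AEC* (2009), VII.2.1, VII.6.3;
J.-P. Serre, *Galois Cohomology* (1997), II §5.7; scope memo HOME/tower/SCOPE-hS34-layer-kernel-at-2-GEN7.md.
-/

set_option autoImplicit false
-- the Theorems namespace of this sub repeats the summit name by design (D-0017 nested layout: Summit.<S>.<Sub>)
set_option linter.dupNamespace false

noncomputable section

open scoped Classical NNReal

namespace Summit.BirchSwinnertonDyer.BirchSwinnertonDyer.Theorems.GoodOrdTower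

open NumberField IsDedekindDomain Field Literature.NumberTheory.EllipticCurves
  Literature.NumberTheory.GaloisRepresentations IsDedekindDomain.HeightOneSpectrum
  Literature.NumberTheory.EllipticCurves.FormalGroupChart Literature.NumberTheory.EllipticCurves.ResKernel
  Literature.NumberTheory.EllipticCurves.Rank1Residual WeierstrassCurve

set_option maxHeartbeats 1600000 in
/-- **`#𝒦_{v,n}[2^∞][2] ≤ 4` at a good ORDINARY `2`, as a KERNEL THEOREM** (no print binder): for `W/ℚ` globally minimal
with good ordinary reduction at `2`, the cyclotomic `ℤ₂`-extension `κ`, a place `v ∣ 2` and a layer `n`, the `2`-torsion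
of the local tower kernel `𝒦_{v,n}[2^∞] = ker(H¹(H_{v,n}, E(K̄_v)) → H¹(H_{v,∞}, E(K̄_v)))[2^∞]` is finite of order at
most `4 = #Ẽ(k̄)[2]_{max} · #(Ê coinvariant bound)`. Drop-in for `pTorsion_localTowerKer_at_two_le_four W hS34 hgo κ hκ v h2v n`.
[cite: GreenbergLNM1716, §2 Prop. 2.5, §3 Lemma 3.4] [cite: SilvermanAEC2009, VII.2.1, VII.6.3]
[cite: SerreGaloisCohomology1997, II §5.7 Thm. 5] -/
theorem pTorsion_localTowerKer_at_two_le_four_kernel (W : WeierstrassCurve ℚ) [W.IsGloballyMinimal] [W.IsElliptic]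
    (hgo : GoodOrd W 2) (κ : ZpExtension ℚ 2) (hκ : κ.IsCyclotomic) (v : HeightOneSpectrum (𝓞 ℚ))
    (h2v : ((2 : ℕ) : 𝓞 ℚ) ∈ v.asIdeal) (n : ℕ) :
    Finite {x : W.localTowerKerPrimary κ (v.adicCompletion ℚ) n // 2 • x = 0} ∧
      Nat.card {x : W.localTowerKerPrimary κ (v.adicCompletion ℚ) n // 2 • x = 0} ≤ 4 := by
  haveI : Fact (Nat.Prime 2) := ⟨Nat.prime_two⟩
  have hord : W.HasGoodReductionAtPrime 2 ∧ ¬ ((2 : ℕ) : ℤ) ∣ W.frobeniusTrace 2 := hgo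
  have hΔ : ¬ ((2 : ℕ) : ℤ) ∣ minimalDiscriminantInt W :=
    W.not_dvd_minimalDiscriminantInt_of_hasGoodReductionAtPrime' 2 hord.1
  have hap := hord.2
  -- the spectral valuation, the model, the reduction map (as in `SelmerCorankControlRatOrdinaryProofs` §1)
  obtain ⟨w, hw⟩ := v.exists_spectralValuation
  have hvO : w.Integers w.valuationSubring := Valuation.valuationSubring.integers w
  have hΔu := W.isUnit_Δ_localIntModel h2v hw hΔ
  let red₀ : localPoints W (v.adicCompletion ℚ) →+
      (((integralModelInt W).map (algebraMap ℤ ↥w.valuationSubring)).map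
        (IsLocalRing.residue ↥w.valuationSubring)).toAffine.Point :=
    (goodReductionHom _ hvO hΔu).comp
      (Affine.Point.congrEquiv (localIntModel_baseChange W w.valuationSubring).symm).toAddMonoidHom
  have hred₀ : ∀ P : localPoints W (v.adicCompletion ℚ), red₀ P =
      ((integralModelInt W).map (algebraMap ℤ ↥w.valuationSubring)).reducePoint
        (Affine.Point.congrEquiv (localIntModel_baseChange W w.valuationSubring).symm P) :=
    fun P ↦ rfl
  have hpO : w ((2 : ℕ) : AlgebraicClosure (v.adicCompletion ℚ)) < 1 := by
    have h := spectralValuation_algebraMap_ringOfIntegers_lt_one (v := v) hw h2v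
    rwa [map_natCast] at h
  haveI hchar : CharP (IsLocalRing.ResidueField ↥w.valuationSubring) 2 := by
    refine (CharP.charP_iff_prime_eq_zero Nat.prime_two).mpr ?_
    rw [← map_natCast (IsLocalRing.residue ↥w.valuationSubring), IsLocalRing.residue_eq_zero_iff,
      IsLocalRing.mem_maximalIdeal, mem_nonunits_iff, hvO.isUnit_iff_valuation_eq_one, map_natCast]
    exact ne_of_lt hpO
  haveI hV : (W.baseChange (AlgebraicClosure (v.adicCompletion ℚ))).IsIntegral w.integer :=
    ⟨⟨(integralModelInt W).map (algebraMap ℤ ↥w.integer), W.baseChange_eq_localIntModel_integer_baseChange⟩⟩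
  -- the Frobenius inside `H_∞`
  obtain ⟨𝔐, h𝔐⟩ := v.localPrimesAbove_nonempty
  have hϖ : Irreducible ((2 : ℕ) : v.adicCompletionIntegers ℚ) := irreducible_natCast_adicCompletionIntegers_rat h2v
  obtain ⟨τ, hτ, hτfix⟩ := exists_isArithFrobAt_forall_smul_eq hw h𝔐 h2v hϖ
  have hτHi : τ ∈ localSubgroup κ.kerSubgroup (v.adicCompletion ℚ) :=
    (mem_localSubgroup_iff _ _ τ).mpr (resGal_mem_kerSubgroup_of_forall_smul_rootOfUnity_eq hκ hτfix)
  -- the ordinary filtration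
  have hordA := W.exists_zsmul_eq_zero_localRed_ne_zero hw hΔu red₀ hred₀ h2v hΔ hap
  obtain ⟨hgenr, -, hdiv₁⟩ := W.localRed_ordinary_filtration hΔu red₀ hred₀ hordA
  obtain ⟨P₁, hP₁0, hP₁ord, hP₁gen⟩ := hgenr 1
  rw [pow_one] at hP₁ord hP₁gen
  have hP₁two : 2 • P₁ = 0 := by rw [← hP₁ord]; exact addOrderOf_nsmul_eq_zero P₁
  have hP₁ne : P₁ ≠ 0 := fun h ↦ by
    rw [h, addOrderOf_zero] at hP₁ord; exact absurd hP₁ord (by norm_num)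
  have hstab : ∀ (σ : absoluteGaloisGroup (v.adicCompletion ℚ)) (Q : localPoints W (v.adicCompletion ℚ)),
      red₀ Q = 0 → red₀ (σ • Q) = 0 :=
    fun σ Q hQ ↦ (W.localRed_smul_eq_zero_iff hw hΔu red₀ hred₀ σ Q).mpr hQ
  -- `A₁[2] = {0, P₁}` and `P₁` is rational
  have hA12 : ∀ a : localPoints W (v.adicCompletion ℚ), red₀ a = 0 → 2 • a = 0 → a = 0 ∨ a = P₁ := by
    intro a ha h2a
    obtain ⟨c, rfl⟩ := hP₁gen a ha (by rw [natCast_zsmul]; exact h2a)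
    rcases Nat.even_or_odd c with ⟨k, rfl⟩ | ⟨k, rfl⟩
    · left; rw [← two_mul, mul_comm, mul_nsmul', hP₁two, nsmul_zero]
    · right; rw [add_nsmul, mul_comm, mul_nsmul', hP₁two, nsmul_zero, zero_add, one_nsmul]
  have hP₁fix : ∀ σ : absoluteGaloisGroup (v.adicCompletion ℚ), σ • P₁ = P₁ := fun σ ↦ by
    rcases hA12 (σ • P₁) (hstab σ P₁ hP₁0) (by rw [← smul_comm, hP₁two, smul_zero]) with h | h
    · exact absurd (smul_eq_zero_iff_eq σ |>.mp h) hP₁ne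
    · exact h
  -- the groups: `H_∞ ⊴ H_n`, an inertial topological generator `g`
  haveI hHiN : (localSubgroup κ.kerSubgroup (v.adicCompletion ℚ)).Normal := by
    rw [localSubgroup_eq_comap]; exact Subgroup.Normal.comap inferInstance _
  obtain ⟨g, hgI, hgn, hgen⟩ := exists_inertial_generator hκ v h2v n
  have hgred : ∀ Q : (localPoints W (v.adicCompletion ℚ)), red₀ (g • Q) = red₀ Q := fun Q ↦
    localRed_smul_eq_of_mem_absInertia W hw red₀ hred₀ h2v h𝔐 hgI Q
  -- `A₁ = ker red₀`, `M₁ = A₁^{H_∞}`, `Aₙ = A₁^{H_n}`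
  let M₁s : AddSubgroup (localPoints W (v.adicCompletion ℚ)) := red₀.ker ⊓ FixedPoints.addSubgroup (localSubgroup κ.kerSubgroup (v.adicCompletion ℚ)) (localPoints W (v.adicCompletion ℚ))
  let Aₙ : AddSubgroup (localPoints W (v.adicCompletion ℚ)) := red₀.ker ⊓ FixedPoints.addSubgroup (localSubgroup (κ.layerSubgroup n) (v.adicCompletion ℚ)) (localPoints W (v.adicCompletion ℚ))
  have hM₁s : ∀ a, a ∈ M₁s ↔ a ∈ red₀.ker ∧ ∀ h ∈ (localSubgroup κ.kerSubgroup (v.adicCompletion ℚ)), h • a = a := fun a ↦ by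
    change a ∈ red₀.ker ⊓ FixedPoints.addSubgroup (localSubgroup κ.kerSubgroup (v.adicCompletion ℚ)) (localPoints W (v.adicCompletion ℚ)) ↔ _
    rw [AddSubgroup.mem_inf, FixedPoints.mem_addSubgroup]
    exact ⟨fun ⟨h1, h2⟩ ↦ ⟨h1, fun σ hσ ↦ h2 ⟨σ, hσ⟩⟩, fun ⟨h1, h2⟩ ↦ ⟨h1, fun σ ↦ h2 σ σ.2⟩⟩
  have hAₙ : ∀ a, a ∈ Aₙ ↔ a ∈ red₀.ker ∧ ∀ σ ∈ (localSubgroup (κ.layerSubgroup n) (v.adicCompletion ℚ)), σ • a = a := fun a ↦ by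
    change a ∈ red₀.ker ⊓ FixedPoints.addSubgroup (localSubgroup (κ.layerSubgroup n) (v.adicCompletion ℚ)) (localPoints W (v.adicCompletion ℚ)) ↔ _
    rw [AddSubgroup.mem_inf, FixedPoints.mem_addSubgroup]
    exact ⟨fun ⟨h1, h2⟩ ↦ ⟨h1, fun σ hσ ↦ h2 ⟨σ, hσ⟩⟩, fun ⟨h1, h2⟩ ↦ ⟨h1, fun σ ↦ h2 σ σ.2⟩⟩
  have hkst : ∀ (σ : absoluteGaloisGroup (v.adicCompletion ℚ)) (a : (localPoints W (v.adicCompletion ℚ))), a ∈ red₀.ker → σ • a ∈ red₀.ker :=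
    fun σ a ha ↦ (AddMonoidHom.mem_ker).mpr (hstab σ a ((AddMonoidHom.mem_ker).mp ha))
  -- `D₁ = g − 1` on `M₁`
  let D₁ : M₁s →+ M₁s :=
    { toFun := fun a ↦ ⟨g • (a : (localPoints W (v.adicCompletion ℚ))) - a, ⟨red₀.ker.sub_mem (hkst g a a.2.1) a.2.1,
        (subOne (localSubgroup κ.kerSubgroup (v.adicCompletion ℚ)) (localPoints W (v.adicCompletion ℚ)) g ⟨(a : (localPoints W (v.adicCompletion ℚ))), a.2.2⟩).2⟩⟩
      map_zero' := Subtype.ext (by simp)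
      map_add' := fun a b ↦ Subtype.ext (by
        simp only [AddSubgroup.coe_add, smul_add]
        abel) }
  have hD₁ : ∀ a : M₁s, ((D₁ a : M₁s) : (localPoints W (v.adicCompletion ℚ))) = g • (a : (localPoints W (v.adicCompletion ℚ))) - a := fun _ ↦ rfl
  -- `Z = ℤ/2 ≅ A₁[2] = {0, P₁}`
  have hf₁ : (zmultiplesHom (localPoints W (v.adicCompletion ℚ)) P₁) (2 : ℤ) = 0 := by
    change (2 : ℤ) • P₁ = 0
    rw [show (2 : ℤ) = ((2 : ℕ) : ℤ) from rfl, natCast_zsmul]; exact hP₁two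
  let ιZ : ZMod 2 →+ (localPoints W (v.adicCompletion ℚ)) := ZMod.lift 2 ⟨zmultiplesHom (localPoints W (v.adicCompletion ℚ)) P₁, hf₁⟩
  have hιZ0 : ιZ 0 = 0 := map_zero ιZ
  have hιZ1 : ιZ 1 = P₁ := by
    have h := ZMod.lift_coe 2 ⟨zmultiplesHom (localPoints W (v.adicCompletion ℚ)) P₁, hf₁⟩ 1
    rw [Int.cast_one] at h
    exact h.trans (one_zsmul P₁)
  have hZcases : ∀ z : ZMod 2, z = 0 ∨ z = 1 := fun z ↦ by
    fin_cases z
    · exact Or.inl rfl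
    · exact Or.inr rfl
  have hιZinj : Function.Injective ιZ := by
    refine (injective_iff_map_eq_zero ιZ).mpr fun z hz ↦ ?_
    rcases hZcases z with rfl | rfl
    · rfl
    · rw [hιZ1] at hz; exact absurd hz hP₁ne
  have hZr : ∀ a : (localPoints W (v.adicCompletion ℚ)), a ∈ red₀.ker ∧ 2 • a = 0 ↔ a ∈ ιZ.range := by
    intro a
    constructor
    · rintro ⟨ha, h2a⟩
      rcases hA12 a ((AddMonoidHom.mem_ker).mp ha) h2a with rfl | rfl
      · exact ⟨0, hιZ0⟩
      · exact ⟨1, hιZ1⟩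
    · rintro ⟨z, rfl⟩
      rcases hZcases z with rfl | rfl
      · rw [hιZ0]; exact ⟨zero_mem _, smul_zero 2⟩
      · rw [hιZ1]; exact ⟨(AddMonoidHom.mem_ker).mpr hP₁0, hP₁two⟩
  have hZfix : ∀ (σ : absoluteGaloisGroup (v.adicCompletion ℚ)) (z : ZMod 2), σ • ιZ z = ιZ z := fun σ z ↦ by
    rcases hZcases z with rfl | rfl
    · rw [hιZ0]; exact smul_zero σ
    · rw [hιZ1]; exact hP₁fix σ
  -- G3 (Kummer count) with G5 (EP count): `#(M₁/(g−1))[2] · #(Aₙ/2) ≤ #Hom(H_n, ℤ/2) ≤ 2^(2^n+2)`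
  obtain ⟨hfinHom, hHom⟩ := natCard_contHom_zmod_two_layer_le hκ v h2v n
  haveI := hfinHom
  have hdiv₁' : ∀ a ∈ red₀.ker, ∃ b ∈ red₀.ker, 2 • b = a := fun a ha ↦ by
    obtain ⟨b, hb, hba⟩ := hdiv₁ a ((AddMonoidHom.mem_ker).mp ha)
    exact ⟨b, (AddMonoidHom.mem_ker).mpr hb, hba⟩
  obtain ⟨hfinM₁, -, hG3⟩ := natCard_torsionBy_coinv_mul_card_quotient_le_card_contHom hκ v h2v W n hgn hgen
    red₀.ker hkst hdiv₁' ιZ hιZinj hZr hZfix M₁s hM₁s D₁ hD₁ Aₙ hAₙ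
  -- G6c (Lutz at the layer): `#(Aₙ/2) = #(ℤ_v/2)^[L_n:ℚ_v] · #Aₙ[2]`, `[L_n:ℚ_v] = 2^n`, `#(ℤ_v/2) = 2`, `#Aₙ[2] ≥ 2`
  haveI := MultTowerNS2.finiteDimensional_fixedField_localSubgroup_layerSubgroup (κ := κ) v n
  have hfr := MultTowerNS2.finrank_fixedField_localSubgroup_layerSubgroup hκ v h2v n
  haveI hVL : (W.baseChange (IntermediateField.fixedField (localSubgroup (κ.layerSubgroup n) (v.adicCompletion ℚ)) : IntermediateField (v.adicCompletion ℚ) (AlgebraicClosure (v.adicCompletion ℚ)))).IsIntegral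
      (w.comap (algebraMap (IntermediateField.fixedField (localSubgroup (κ.layerSubgroup n) (v.adicCompletion ℚ)) : IntermediateField (v.adicCompletion ℚ) (AlgebraicClosure (v.adicCompletion ℚ))) (AlgebraicClosure (v.adicCompletion ℚ)))).integer := by
    refine ⟨⟨(integralModelInt W).map (algebraMap ℤ _), ?_⟩⟩
    conv_lhs => rw [← map_integralModelInt W]
    rw [baseChange, baseChange, WeierstrassCurve.map_map, WeierstrassCurve.map_map]
    congr 1
    exact RingHom.ext_int _ _
  have hAH : ∀ Q : (localPoints W (v.adicCompletion ℚ)), Q ∈ Aₙ ↔ (Q : (W.baseChange (AlgebraicClosure (v.adicCompletion ℚ))).toAffine.Point) ∈ kernel w (W.baseChange (AlgebraicClosure (v.adicCompletion ℚ))) ∧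
      ∀ σ ∈ (localSubgroup (κ.layerSubgroup n) (v.adicCompletion ℚ)), σ • Q = Q := fun Q ↦ by
    rw [hAₙ, AddMonoidHom.mem_ker, W.localRed_eq_zero_iff_mem_kernel hΔu red₀ hred₀ Q]
  obtain ⟨-, hfinker, hLutz⟩ := natCard_quotient_nsmul_fixedKernel_eq (K := ℚ) (v := v) hw h2v W (localSubgroup (κ.layerSubgroup n) (v.adicCompletion ℚ)) Aₙ hAH
  have hO2 : Nat.card (v.adicCompletionIntegers ℚ ⧸ Ideal.span {((2 : ℕ) : v.adicCompletionIntegers ℚ)}) = 2 := by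
    rw [← (IsDiscreteValuationRing.irreducible_iff_uniformizer _).mp hϖ]
    change Nat.card (IsLocalRing.ResidueField (v.adicCompletionIntegers ℚ)) = 2
    rw [natCard_residueField_adicCompletionIntegers v, Rat.HeightOneSpectrum.primesEquiv_eq_of_natCast_mem v Nat.prime_two h2v]
  haveI := hfinker
  have hker2 : 2 ≤ Nat.card (nsmulAddMonoidHom 2 : Aₙ →+ Aₙ).ker := by
    have hP₁A : P₁ ∈ Aₙ := (hAₙ P₁).mpr ⟨(AddMonoidHom.mem_ker).mpr hP₁0, fun σ _ ↦ hP₁fix σ⟩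
    have hP₁k : (⟨P₁, hP₁A⟩ : Aₙ) ∈ (nsmulAddMonoidHom 2 : Aₙ →+ Aₙ).ker := by
      rw [AddMonoidHom.mem_ker, nsmulAddMonoidHom_apply]; exact Subtype.ext hP₁two
    haveI : Nontrivial (nsmulAddMonoidHom 2 : Aₙ →+ Aₙ).ker :=
      ⟨⟨0, ⟨⟨P₁, hP₁A⟩, hP₁k⟩, fun h ↦ hP₁ne (congrArg (fun x ↦ ((x.1 : Aₙ) : (localPoints W (v.adicCompletion ℚ)))) h).symm⟩⟩
    exact Finite.one_lt_card
  have hc₁ : Nat.card {c : M₁s ⧸ D₁.range // 2 • c = 0} ≤ 2 := by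
    rw [hLutz, hO2, hfr] at hG3
    have h4 : (2 : ℕ) ^ (2 ^ n + 2) = 2 ^ 2 ^ n * 4 := by rw [pow_add]; norm_num
    have h := hG3.trans (hHom.trans h4.le)
    have hpos : 0 < (2 : ℕ) ^ 2 ^ n := by positivity
    have h1 : Nat.card {c : M₁s ⧸ D₁.range // 2 • c = 0} * 2 * 2 ^ 2 ^ n ≤ 4 * 2 ^ 2 ^ n :=
      calc Nat.card {c : M₁s ⧸ D₁.range // 2 • c = 0} * 2 * 2 ^ 2 ^ n
          ≤ Nat.card {c : M₁s ⧸ D₁.range // 2 • c = 0} *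
              Nat.card (nsmulAddMonoidHom 2 : Aₙ →+ Aₙ).ker * 2 ^ 2 ^ n := by gcongr
        _ = Nat.card {c : M₁s ⧸ D₁.range // 2 • c = 0} *
              (2 ^ 2 ^ n * Nat.card (nsmulAddMonoidHom 2 : Aₙ →+ Aₙ).ker) := by ring
        _ ≤ 2 ^ 2 ^ n * 4 := h
        _ = 4 * 2 ^ 2 ^ n := by ring
    have h2 := Nat.le_of_mul_le_mul_right h1 hpos
    omega
  -- G4 §D: `#Ẽ(k̄)[2] ≤ 2`
  obtain ⟨hfinT, hT⟩ := finite_torsionBy_localRed_target_and_card_le W hΔu red₀ hred₀ hordA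
  haveI := hfinT
  haveI := hfinM₁
  -- G1 (dévissage along `red₀`) on `M = E(K̄_v)^{H_∞}`, `D = g − 1`
  have hrD : ∀ x : FixedPoints.addSubgroup (localSubgroup κ.kerSubgroup (v.adicCompletion ℚ)) (localPoints W (v.adicCompletion ℚ)),
      (red₀.comp (FixedPoints.addSubgroup (localSubgroup κ.kerSubgroup (v.adicCompletion ℚ)) (localPoints W (v.adicCompletion ℚ))).subtype) (subOne (localSubgroup κ.kerSubgroup (v.adicCompletion ℚ)) (localPoints W (v.adicCompletion ℚ)) g x) = 0 := fun x ↦ by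
    rw [AddMonoidHom.comp_apply, AddSubgroup.coe_subtype, coe_subOne_apply, map_sub, hgred, sub_self]
  have hlift : ∀ x : FixedPoints.addSubgroup (localSubgroup κ.kerSubgroup (v.adicCompletion ℚ)) (localPoints W (v.adicCompletion ℚ)), ∃ x₀ : FixedPoints.addSubgroup (localSubgroup κ.kerSubgroup (v.adicCompletion ℚ)) (localPoints W (v.adicCompletion ℚ)),
      subOne (localSubgroup κ.kerSubgroup (v.adicCompletion ℚ)) (localPoints W (v.adicCompletion ℚ)) g x₀ = 0 ∧ (red₀.comp (FixedPoints.addSubgroup (localSubgroup κ.kerSubgroup (v.adicCompletion ℚ)) (localPoints W (v.adicCompletion ℚ))).subtype) x₀ =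
        (red₀.comp (FixedPoints.addSubgroup (localSubgroup κ.kerSubgroup (v.adicCompletion ℚ)) (localPoints W (v.adicCompletion ℚ))).subtype) x := fun x ↦ by
    have hτx : τ • (x : (localPoints W (v.adicCompletion ℚ))) = x := (FixedPoints.mem_addSubgroup _ _ _).mp x.2 ⟨τ, hτHi⟩
    obtain ⟨P₀, hP₀fix, hP₀⟩ := exists_fixed_localRed_eq W hw hΔu red₀ hred₀ h2v hΔ h𝔐 hτ (x : (localPoints W (v.adicCompletion ℚ))) (by rw [hτx])
    refine ⟨⟨P₀, (FixedPoints.mem_addSubgroup _ _ _).mpr fun σ ↦ hP₀fix σ⟩, Subtype.ext ?_, ?_⟩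
    · rw [coe_subOne_apply, hP₀fix, sub_self]; rfl
    · simpa using hP₀
  have hrj : ∀ y : FixedPoints.addSubgroup (localSubgroup κ.kerSubgroup (v.adicCompletion ℚ)) (localPoints W (v.adicCompletion ℚ)), (red₀.comp (FixedPoints.addSubgroup (localSubgroup κ.kerSubgroup (v.adicCompletion ℚ)) (localPoints W (v.adicCompletion ℚ))).subtype) y = 0 →
      ∃ x : M₁s, AddSubgroup.inclusion (inf_le_right : M₁s ≤ FixedPoints.addSubgroup (localSubgroup κ.kerSubgroup (v.adicCompletion ℚ)) (localPoints W (v.adicCompletion ℚ))) x = y :=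
    fun y hy ↦ ⟨⟨y, ⟨(AddMonoidHom.mem_ker).mpr hy, y.2⟩⟩, rfl⟩
  have hD₁j : ∀ x : M₁s, AddSubgroup.inclusion (inf_le_right : M₁s ≤ FixedPoints.addSubgroup (localSubgroup κ.kerSubgroup (v.adicCompletion ℚ)) (localPoints W (v.adicCompletion ℚ))) (D₁ x) =
      subOne (localSubgroup κ.kerSubgroup (v.adicCompletion ℚ)) (localPoints W (v.adicCompletion ℚ)) g (AddSubgroup.inclusion (inf_le_right : M₁s ≤ FixedPoints.addSubgroup (localSubgroup κ.kerSubgroup (v.adicCompletion ℚ)) (localPoints W (v.adicCompletion ℚ))) x) :=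
    fun x ↦ Subtype.ext rfl
  obtain ⟨hfinM, hG1⟩ := natCard_torsionBy_quotient_le_of_invariant (subOne (localSubgroup κ.kerSubgroup (v.adicCompletion ℚ)) (localPoints W (v.adicCompletion ℚ)) g)
    (red₀.comp (FixedPoints.addSubgroup (localSubgroup κ.kerSubgroup (v.adicCompletion ℚ)) (localPoints W (v.adicCompletion ℚ))).subtype) hrD hlift
    (AddSubgroup.inclusion (inf_le_right : M₁s ≤ FixedPoints.addSubgroup (localSubgroup κ.kerSubgroup (v.adicCompletion ℚ)) (localPoints W (v.adicCompletion ℚ))))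
    (AddSubgroup.inclusion_injective _) hrj D₁ hD₁j 2
  -- BRICK 11: `𝒦_{v,n}[2^∞][2] ↪ (M/(g−1)M)[2]`
  haveI := hfinM
  obtain ⟨hfinK, hK⟩ := MultTowerNS2.finite_torsionBy_localTowerKerPrimary_and_card_le W κ (v.adicCompletion ℚ) n hgn hgen 2
  refine ⟨hfinK, hK.trans (hG1.trans ?_)⟩
  calc Nat.card {c : M₁s ⧸ D₁.range // 2 • c = 0} *
        Nat.card {t : (((integralModelInt W).map (algebraMap ℤ ↥w.valuationSubring)).map
          (IsLocalRing.residue ↥w.valuationSubring)).toAffine.Point // 2 • t = 0} ≤ 2 * 2 :=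
        Nat.mul_le_mul hc₁ hT
    _ = 4 := by norm_num

end Summit.BirchSwinnertonDyer.BirchSwinnertonDyer.Theorems.GoodOrdTower

end
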